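import Summits.RiemannHypothesis.RiemannHypothesis.Theorems.SoninCertEta
import Summits.RiemannHypothesis.RiemannHypothesis.Theorems.SoninCertBKernel
import HarnessLib

/-!
# Sonin-space certificate at `b = 107/200`, P4-A: the kernel `k_G = G ⋆ G̃` and the scaling coefficient of `η` in closed form

Cell `rh-explicit`, seat cc-s2-3, Phase 2 (lead R7-12/R7-12a), file P4-A of the `B`-side (`B = Re ⟨η | ϑ(T₂ k_G) η⟩`,
the quantity the kernel file `SoninCertBKernel` encloses).  Two closed forms, both elementary:

* `weilConv_G`: for the polynomial window `G = polyWitness gL bQ` (real, supported in `[−b, b]`), the kernel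
  `k_G(τ) = (G ⋆ G̃)(τ) = ∫ G(x + |τ|) G(x) dx` is the even extension of cc-s2-4's autocorrelation list
  `kappaL gL bQ`, which is the literal `kapLit` of the kernel file (`kapLit_eq`, `decide`), cut off at `|τ| = 2b`;
* `re_scalingCoeff_eta`: for the Sonin-side vector `η = R(|x|)·1_{1 ≤ |x| ≤ 8}` (`SoninCertEta.eta`) and
  `0 ≤ s` with `e^s < 8`,
  `Re ⟨η | ϑ(e^s) η⟩ = 2e^{−s/2} ∫_{e^s}^{8} R(v) R(e^{−s}v) dv = Σ_k 2 r_k (P_k(8) e^{−(2k+1)s/2} − Σ_n (P_k)_n e^{(2(n−k)−1)s/2})`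
  (`P_k = ∫_0 v^k R = pkList k`), written as the finite exponential sum `cfun s`; and the coefficient is even in `s`
  (`re_scalingCoeff_eta_neg`, from unitarity `scalingCoeff_neg`).

Definitions (closed-form bookkeeping only, all the `B`-side files' real-side objects live here so that P4-B/C/D are proof-only): `expq`, `kapFun`, `cfun`, `cre`, `J0R`, `JLR`, `JRR`, `combR`, `Bform`, `Breal`, `phiq`, `taylorR`.  No facts, no axioms; nothing about `ζ`.
-/

set_option linter.dupNamespace false  -- the mandated namespace repeats `RiemannHypothesis`

noncomputable section

open MeasureTheory Complex Set Finset
open scoped Real ComplexConjugate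
open Summit.RiemannHypothesis.RiemannHypothesis.Theorems.SemilocalPolyWitness
open Summit.RiemannHypothesis.RiemannHypothesis.BandEnergy (monomialL ev_monomialL)
open Literature.NumberTheory.ConnesConsani2021 Literature.NumberTheory.LFunctions

namespace Summit.RiemannHypothesis.RiemannHypothesis.SoninCert

/-! ## The kernel `k_G = G ⋆ G̃` -/

set_option maxHeartbeats 0 in  -- kernel evaluation of literal data; no search
/-- cc-s2-4's computed autocorrelation list of the window `gL` on `[−bQ, bQ]` is the literal `kapLit`. [folklore] -/
theorem kapLit_eq : kappaL gL bQ = kapLit := by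
  decide +kernel

/-- `e^{q u / 2}` for an integer `q` (the exponentials `e^{β u}`, `β = q/2`, of the certificate). [folklore] -/
def expq (q : ℤ) (u : ℝ) : ℝ := Real.exp ((q : ℝ) * u / 2)

/-- The kernel `k_G(τ) = κ(|τ|)·1_{|τ| ≤ 2b}` as a real function, `κ = ev kapLit`. [folklore] -/
def kapFun (u : ℝ) : ℝ := if |u| ≤ 2 * (bQ : ℝ) then LQ.ev kapLit |u| else 0

/-- `kapFun` is even. [folklore] -/
theorem kapFun_neg (u : ℝ) : kapFun (-u) = kapFun u := by
  simp [kapFun, abs_neg]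

/-- `kapFun` vanishes off `[−2b, 2b]`. [folklore] -/
theorem kapFun_eq_zero {u : ℝ} (hu : 2 * (bQ : ℝ) < |u|) : kapFun u = 0 := by
  simp [kapFun, not_le.2 hu]

/-- On `[−2b, 2b]`: `kapFun u = κ(|u|)`. [folklore] -/
theorem kapFun_of_abs_le {u : ℝ} (hu : |u| ≤ 2 * (bQ : ℝ)) : kapFun u = LQ.ev kapLit |u| := by
  unfold kapFun; rw [if_pos hu]

/-- On `[0, 2b]`: `kapFun u = κ(u)`. [folklore] -/
theorem kapFun_of_mem {u : ℝ} (hu : u ∈ Icc (0 : ℝ) (2 * bQ)) : kapFun u = LQ.ev kapLit u := by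
  rw [kapFun_of_abs_le (by rw [abs_of_nonneg hu.1]; exact hu.2), abs_of_nonneg hu.1]

/-- `|kapFun u| ≤ absBound kapLit (2b)`. [folklore] -/
theorem abs_kapFun_le (u : ℝ) : |kapFun u| ≤ (LQ.absBound kapLit (2 * bQ) : ℝ) := by
  unfold kapFun
  split_ifs with h
  · exact LQ.abs_ev_le_absBound kapLit (by rw [abs_abs]; exact_mod_cast h)
  · rw [abs_zero]; exact_mod_cast LQ.absBound_nonneg kapLit (by rw [bQ]; norm_num)

/-- `kapFun` is measurable. [folklore] -/
theorem measurable_kapFun : Measurable kapFun := by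
  refine Measurable.ite (measurableSet_le measurable_norm measurable_const) ?_ measurable_const
  exact ((LQ.continuous_ev kapLit).comp continuous_norm).measurable

/-- `∫ g(x + t) g(x) dx = kapFun t` for `t ≥ 0` (`g = polyWitnessRe gL bQ`). [folklore] -/
theorem integral_shift_mul_eq_kapFun {t : ℝ} (ht : 0 ≤ t) :
    ∫ x, polyWitnessRe gL bQ (x + t) * polyWitnessRe gL bQ x = kapFun t := by
  unfold kapFun
  rw [abs_of_nonneg ht]
  split_ifs with h
  · rw [integral_polyWitnessRe_shift_mul ht h, kapLit_eq]
  · exact integral_polyWitnessRe_shift_mul_of_lt (not_le.1 h)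

/-- **The kernel in closed form**: `(G ⋆ G̃)(τ) = kapFun τ` for `G = polyWitness gL bQ`. [folklore] -/
theorem weilConv_G (τ : ℝ) :
    weilConv (polyWitness gL bQ) (weilReflect (polyWitness gL bQ)) τ = ((kapFun τ : ℝ) : ℂ) := by
  rw [weilConv_apply]
  have e : ∀ u, polyWitness gL bQ u * weilReflect (polyWitness gL bQ) (τ - u)
      = ((polyWitnessRe gL bQ u * polyWitnessRe gL bQ (u - τ) : ℝ) : ℂ) := fun u => by
    simp only [weilReflect, polyWitness, Complex.conj_ofReal, neg_sub]; push_cast; ring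
  simp_rw [e]
  rw [integral_complex_ofReal]
  congr 1
  rcases le_or_gt 0 τ with hτ | hτ
  · rw [← integral_add_right_eq_self (fun u => polyWitnessRe gL bQ u * polyWitnessRe gL bQ (u - τ)) τ]
    simp only [add_sub_cancel_right]
    exact integral_shift_mul_eq_kapFun hτ
  · rw [← kapFun_neg, ← integral_shift_mul_eq_kapFun (by linarith)]
    refine integral_congr_ae (Filter.Eventually.of_forall fun u => ?_)
    simp only [sub_eq_add_neg, mul_comm]

/-- The kernel, as a function. [folklore] -/
theorem weilConv_G_eq : weilConv (polyWitness gL bQ) (weilReflect (polyWitness gL bQ)) = fun τ => ((kapFun τ : ℝ) : ℂ) :=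
  funext weilConv_G

/-! ## The scaling coefficient `⟨η | ϑ(e^s) η⟩` -/

/-- On `a ≤ v ≤ 8` (`1 ≤ a`): `η(v) = R(v)` and `η(a⁻¹v) = R(a⁻¹v)`. [folklore] -/
theorem etaFun_mul_dil_of_mem {a v : ℝ} (ha1 : 1 ≤ a) (hv : v ∈ Icc a 8) :
    conj (etaFun v) * etaFun (a⁻¹ * v) = ((LQ.ev rL v * LQ.ev rL (a⁻¹ * v) : ℝ) : ℂ) := by
  have ha0 : 0 < a := by linarith
  have h1 : v ∈ Icc (1 : ℝ) 8 := ⟨by linarith [hv.1], hv.2⟩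
  have h2 : a⁻¹ * v ∈ Icc (1 : ℝ) 8 := by
    constructor
    · rw [le_inv_mul_iff₀ ha0]; linarith [hv.1]
    · rw [inv_mul_le_iff₀ ha0]; nlinarith [hv.2]
  rw [etaFun_of_mem h1, etaFun_of_mem h2, Complex.conj_ofReal]; push_cast; ring

/-- The product `conj η(v)·η(a⁻¹v)` vanishes unless `a ≤ |v| ≤ 8`. [folklore] -/
theorem etaFun_mul_dil_eq_zero {a v : ℝ} (ha0 : 0 < a) (h1 : v ∉ Icc a 8) (h2 : v ∉ Icc (-8 : ℝ) (-a)) :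
    conj (etaFun v) * etaFun (a⁻¹ * v) = 0 := by
  by_cases h8 : v ∈ Icc (-8 : ℝ) 8
  · have hlt : |a⁻¹ * v| < 1 := by
      rw [abs_mul, abs_of_pos (inv_pos.2 ha0), inv_mul_lt_iff₀ ha0, mul_one, abs_lt]
      constructor
      · by_contra h; exact h2 ⟨h8.1, by linarith⟩
      · by_contra h; exact h1 ⟨by linarith, h8.2⟩
    rw [etaFun_eq_zero_of_abs_lt hlt, mul_zero]
  · rw [etaFun_eq_zero_of_not_mem h8, map_zero, zero_mul]

/-- `∫ conj η(v) η(a⁻¹ v) dv = 2 ∫_a^8 R(v) R(a⁻¹v) dv` for `1 ≤ a < 8`. [folklore] -/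
theorem integral_conj_etaFun_mul_dil {a : ℝ} (ha1 : 1 ≤ a) (ha8 : a < 8) :
    ∫ v, conj (etaFun v) * etaFun (a⁻¹ * v)
      = ((2 * ∫ v in a..8, LQ.ev rL v * LQ.ev rL (a⁻¹ * v) : ℝ) : ℂ) := by
  have ha0 : 0 < a := by linarith
  set f : ℝ → ℝ := fun v => LQ.ev rL v * LQ.ev rL (a⁻¹ * v) with hf
  have hfc : Continuous f := (LQ.continuous_ev _).mul ((LQ.continuous_ev _).comp (continuous_const.mul continuous_id))
  have hsplit : (fun v => conj (etaFun v) * etaFun (a⁻¹ * v))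
      = (Icc a 8).indicator (fun v => ((f v : ℝ) : ℂ)) + (Icc (-8 : ℝ) (-a)).indicator (fun v => ((f (-v) : ℝ) : ℂ)) := by
    funext v
    simp only [Pi.add_apply]
    by_cases h1 : v ∈ Icc a 8
    · have h2 : v ∉ Icc (-8 : ℝ) (-a) := fun h => by linarith [h.2, h1.1]
      rw [indicator_of_mem h1, indicator_of_notMem h2, add_zero, etaFun_mul_dil_of_mem ha1 h1]
    · by_cases h2 : v ∈ Icc (-8 : ℝ) (-a)
      · have h1' : -v ∈ Icc a 8 := ⟨by linarith [h2.2], by linarith [h2.1]⟩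
        rw [indicator_of_notMem h1, indicator_of_mem h2, zero_add, ← etaFun_neg v, ← etaFun_neg (a⁻¹ * v),
          show -(a⁻¹ * v) = a⁻¹ * (-v) by ring, etaFun_mul_dil_of_mem ha1 h1']
      · rw [indicator_of_notMem h1, indicator_of_notMem h2, add_zero, etaFun_mul_dil_eq_zero ha0 h1 h2]
  have hc1 : Continuous fun v : ℝ => ((f v : ℝ) : ℂ) := Complex.continuous_ofReal.comp hfc
  have hc2 : Continuous fun v : ℝ => ((f (-v) : ℝ) : ℂ) := Complex.continuous_ofReal.comp (hfc.comp continuous_neg)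
  rw [hsplit, integral_add' (hc1.integrableOn_Icc.integrable_indicator measurableSet_Icc)
    (hc2.integrableOn_Icc.integrable_indicator measurableSet_Icc),
    integral_indicator measurableSet_Icc, integral_indicator measurableSet_Icc, integral_complex_ofReal,
    integral_complex_ofReal, integral_Icc_eq_integral_Ioc, ← intervalIntegral.integral_of_le ha8.le,
    integral_Icc_eq_integral_Ioc, ← intervalIntegral.integral_of_le (by linarith : (-8 : ℝ) ≤ -a),
    intervalIntegral.integral_comp_neg (fun v => f v)]
  push_cast
  simp only [neg_neg]
  ring

/-- `rL` has 35 entries. [folklore] -/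
theorem length_rL : rL.length = 35 := rfl

/-- `∫_a^w R(v) R(c v) dv = Σ_k r_k c^k (P_k(w) − P_k(a))`, `P_k = ev (pkList k)`. [folklore] -/
theorem intervalIntegral_R_mul_R_dil (c a w : ℝ) :
    ∫ v in a..w, LQ.ev rL v * LQ.ev rL (c * v)
      = ∑ k ∈ range 35, (rL.getD k 0 : ℝ) * c ^ k * (LQ.ev (pkList k) w - LQ.ev (pkList k) a) := by
  have e : (fun v => LQ.ev rL v * LQ.ev rL (c * v))
      = fun v => ∑ k ∈ range 35, ((rL.getD k 0 : ℝ) * c ^ k) * LQ.ev (LQ.mul (monomialL k) rL) v := by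
    funext v
    rw [LQ.ev_eq_sum rL (c * v), length_rL, Finset.mul_sum]
    refine Finset.sum_congr rfl fun k _ => ?_
    rw [LQ.ev_mul, ev_monomialL, mul_pow]; ring
  rw [e, intervalIntegral.integral_finsetSum]
  · refine Finset.sum_congr rfl fun k _ => ?_
    rw [intervalIntegral.integral_const_mul, LQ.integral_ev]
    rfl
  · intro k _
    exact (Continuous.mul continuous_const (LQ.continuous_ev _)).intervalIntegrable _ _

/-- The closed form `c(s) = Σ_k (2 r_k P_k(8)) e^{−(2k+1)s/2} + Σ_{k,n} (−2 r_k (P_k)_n) e^{(2(n−k)−1)s/2}`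
of `Re ⟨η | ϑ(e^s) η⟩` (`0 ≤ s`, `e^s < 8`); the index ranges and the integer labels are those of the kernel
file's `termK`/`termKN`. [folklore] -/
def cfun (s : ℝ) : ℝ :=
  ∑ k ∈ range 35, (((2 * rL.getD k 0 * LQ.evQ (pkList k) 8 : ℚ) : ℝ) * expq (-(2 * (k : ℤ) + 1)) s
    + ∑ n ∈ range 75, ((-2 * rL.getD k 0 * (pkList k).getD n 0 : ℚ) : ℝ) * expq (2 * ((n : ℤ) - k) - 1) s)

/-! ## Real-side bookkeeping for the `B`-certificate (used by files P4-B/C/D) -/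

/-- `c(τ) = Re ⟨η | ϑ(e^τ) η⟩`. [folklore] -/
def cre (τ : ℝ) : ℝ := (scalingCoeff (eta : ℝ → ℂ) (eta : ℝ → ℂ) τ).re

/-- `J0(q) = ∫_0^{2b} κ(u) e^{qu/2} du`. [folklore] -/
def J0R (q : ℤ) : ℝ := ∫ u in (0 : ℝ)..(2 * bQ), LQ.ev kapLit u * expq q u

/-- `JL(q) = ∫_0^{log 2} κ(u) e^{qu/2} du`. [folklore] -/
def JLR (q : ℤ) : ℝ := ∫ u in (0 : ℝ)..(Real.log 2), LQ.ev kapLit u * expq q u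

/-- `JR(q) = ∫_{log 2}^{2b} κ(u) e^{qu/2} du`. [folklore] -/
def JRR (q : ℤ) : ℝ := ∫ u in (Real.log 2)..(2 * bQ), LQ.ev kapLit u * expq q u

/-- `Comb(q/2) = (3 − 2^m) J0(q) − 2^m JL(−q) − 2^{1−m} JR(q)`, `m = (q+1)/2` (meaningful for odd `q`). [folklore] -/
def combR (q : ℤ) : ℝ :=
  ((3 - 2 ^ ((q + 1) / 2) : ℚ) : ℝ) * J0R q - ((2 ^ ((q + 1) / 2) : ℚ) : ℝ) * JLR (-q)
    - ((2 ^ (1 - (q + 1) / 2) : ℚ) : ℝ) * JRR q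

/-- The linear functional `F ↦ Σ_k (2 r_k P_k(8)) F(−(2k+1)) + Σ_{k,n} (−2 r_k (P_k)_n) F(2(n−k)−1)` (the index
pattern of `cfun` and of the kernel file's `termK`/`termKN`). [folklore] -/
def Bform (F : ℤ → ℝ) : ℝ :=
  ∑ k ∈ range 35, (((2 * rL.getD k 0 * LQ.evQ (pkList k) 8 : ℚ) : ℝ) * F (-(2 * (k : ℤ) + 1))
    + ∑ n ∈ range 75, ((-2 * rL.getD k 0 * (pkList k).getD n 0 : ℚ) : ℝ) * F (2 * ((n : ℤ) - k) - 1))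

/-- **The real number `B`** of the certificate, as the finite sum the kernel evaluates. [folklore] -/
def Breal : ℝ := Bform combR

/-- The combination `Φ_q(u) = 3e^{qu/2} − 2e^{−L/2}(e^{q(u+L)/2} + e^{q|u−L|/2})`. [folklore] -/
def phiq (q : ℤ) (u : ℝ) : ℝ :=
  3 * expq q u - 2 * Real.exp (-(Real.log 2 / 2)) * (expq q (u + Real.log 2) + expq q |u - Real.log 2|)

/-- `taylorR x f n m = f m + (x/(m+1))·(f (m+1) + (x/(m+2))·(…))` (`n` terms). [folklore] -/
def taylorR (x : ℝ) (f : ℕ → ℝ) : ℕ → ℕ → ℝ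
  | 0, _ => 0
  | n + 1, m => f m + x / (m + 1) * taylorR x f n (m + 1)


/-- Every `pkList k`, `k < 35`, has at most `75` coefficients (kernel check). [folklore] -/
theorem length_pkList_le : ∀ k ∈ range 35, (pkList k).length ≤ 75 := by
  have h : ((List.range 35).all fun k => decide ((pkList k).length ≤ 75)) = true := by decide +kernel
  intro k hk
  have := List.all_eq_true.1 h k (List.mem_range.2 (Finset.mem_range.1 hk))
  exact of_decide_eq_true this

/-- Sum form of `ev` over any index range covering the list. [folklore] -/
theorem ev_eq_sum_of_le (p : List ℚ) {N : ℕ} (hN : p.length ≤ N) (x : ℝ) :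
    LQ.ev p x = ∑ j ∈ range N, ((p.getD j 0 : ℚ) : ℝ) * x ^ j := by
  rw [LQ.ev_eq_sum]
  refine Finset.sum_subset (Finset.range_mono hN) fun j hj hj' => ?_
  rw [List.getD_eq_default _ _ (by simpa using hj'), Rat.cast_zero, zero_mul]

/-- **The scaling coefficient in closed form**: `Re ⟨η | ϑ(e^s) η⟩ = cfun s` for `0 ≤ s`, `e^s < 8`. [folklore] -/
theorem re_scalingCoeff_eta {s : ℝ} (hs0 : 0 ≤ s) (hs8 : Real.exp s < 8) :
    (scalingCoeff (eta : ℝ → ℂ) (eta : ℝ → ℂ) s).re = cfun s := by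
  set a : ℝ := Real.exp s with ha
  have ha1 : 1 ≤ a := by rw [ha]; exact Real.one_le_exp hs0
  have ha0 : 0 < a := by linarith
  have hexp : Real.exp (-s) = a⁻¹ := by rw [Real.exp_neg]
  have h1 := eta_coeFn
  have h2 : (fun v : ℝ => (eta : ℝ → ℂ) (a⁻¹ * v)) =ᵐ[volume] fun v => etaFun (a⁻¹ * v) :=
    (Literature.Analysis.OperatorTheory.quasiMeasurePreserving_smul' (V := ℝ) (inv_ne_zero ha0.ne')).ae_eq h1
  have hsc : scalingCoeff (eta : ℝ → ℂ) (eta : ℝ → ℂ) s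
      = (Real.exp (-s / 2) : ℂ) * ∫ v, conj (etaFun v) * etaFun (a⁻¹ * v) := by
    unfold scalingCoeff
    rw [← integral_const_mul]
    refine integral_congr_ae ?_
    filter_upwards [h1, h2] with v hv hv2
    rw [hv, hexp, hv2]; ring
  rw [hsc, integral_conj_etaFun_mul_dil ha1 hs8, intervalIntegral_R_mul_R_dil, ← Complex.ofReal_mul,
    Complex.ofReal_re, cfun, Finset.mul_sum, Finset.mul_sum]
  refine Finset.sum_congr rfl fun k hk => ?_
  have hM8 : LQ.ev (pkList k) 8 = ((LQ.evQ (pkList k) 8 : ℚ) : ℝ) := by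
    rw [← LQ.ev_ratCast]; norm_num
  rw [hM8, ev_eq_sum_of_le (pkList k) (length_pkList_le k hk) a]
  -- exponentials: `a⁻¹ ^ k = e^{-ks}`, `a ^ n = e^{ns}`
  have hak : (a⁻¹) ^ k = Real.exp (-(k : ℝ) * s) := by
    rw [← hexp, ← Real.exp_nat_mul]; ring_nf
  have han : ∀ n : ℕ, a ^ n = Real.exp ((n : ℝ) * s) := fun n => by
    rw [ha, ← Real.exp_nat_mul]
  have e1 : Real.exp (-s / 2) * Real.exp (-(k : ℝ) * s) = expq (-(2 * (k : ℤ) + 1)) s := by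
    rw [expq, ← Real.exp_add]; push_cast; ring_nf
  have e2 : ∀ n : ℕ, Real.exp (-s / 2) * Real.exp (-(k : ℝ) * s) * Real.exp ((n : ℝ) * s)
      = expq (2 * ((n : ℤ) - k) - 1) s := fun n => by
    rw [expq, ← Real.exp_add, ← Real.exp_add]; push_cast; ring_nf
  rw [hak]
  simp_rw [han]
  have eR : ∑ n ∈ range 75, ((-2 * rL.getD k 0 * (pkList k).getD n 0 : ℚ) : ℝ) * expq (2 * ((n : ℤ) - k) - 1) s
      = -(2 * Real.exp (-s / 2) * ((rL.getD k 0 : ℝ) * Real.exp (-(k : ℝ) * s)))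
          * ∑ n ∈ range 75, (((pkList k).getD n 0 : ℚ) : ℝ) * Real.exp ((n : ℝ) * s) := by
    rw [Finset.mul_sum]
    exact Finset.sum_congr rfl fun n _ => by rw [← e2 n]; push_cast; ring
  rw [eR, ← e1]
  push_cast
  ring

/-- **Evenness**: `Re ⟨η | ϑ(e^{−s}) η⟩ = Re ⟨η | ϑ(e^{s}) η⟩` (unitarity of `ϑ`). [folklore] -/
theorem re_scalingCoeff_eta_neg (s : ℝ) :
    (scalingCoeff (eta : ℝ → ℂ) (eta : ℝ → ℂ) (-s)).re = (scalingCoeff (eta : ℝ → ℂ) (eta : ℝ → ℂ) s).re := by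
  rw [scalingCoeff_neg, Complex.conj_re]

/-- `|Re ⟨η | ϑ(e^s) η⟩| ≤ ‖η‖²`. [folklore] -/
theorem abs_re_scalingCoeff_eta_le (s : ℝ) :
    |(scalingCoeff (eta : ℝ → ℂ) (eta : ℝ → ℂ) s).re| ≤ ‖eta‖ ^ 2 := by
  rw [sq]
  exact (Complex.abs_re_le_norm _).trans (norm_scalingCoeff_le eta eta s)

/-- `s ↦ Re ⟨η | ϑ(e^s) η⟩` is continuous. [folklore] -/
theorem continuous_re_scalingCoeff_eta :
    Continuous fun s : ℝ => (scalingCoeff (eta : ℝ → ℂ) (eta : ℝ → ℂ) s).re :=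
  Complex.continuous_re.comp (continuous_scalingCoeff eta eta)

end Summit.RiemannHypothesis.RiemannHypothesis.SoninCert
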